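import Mathlib
import Summits.Ventures.PercRepro2.HCov
import Summits.Ventures.PercRepro2.RootLeafOCells
import Summits.Ventures.PercRepro2.RootLeafUPocketShare
import Summits.Ventures.PercRepro2.RootLeafUPocket3Graph

/-!
# The joint atoms of a three-terminal pocket: outside pattern × pocket pattern
(blind cell PercRepro2, p4 g20; S3 (G4-u) item (ah), the OUTSIDE BRIDGE of P4-G19-OUTSIDE.md §8 / §9 (b))

A pocket `P ∋ b` with terminal set `{u, a₂, c}` (`hP`), an outside vertex `x₀ ∉ P`, and the two parts
`off ω` / `inn ω` of a configuration (RootLeafUPocketGraph).  The **outside state** of `ω` is the pattern of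
the six pair connections of `off ω` on four outside points `(p, q, r, s)` (a 6-tuple of Booleans), the
**pocket state** the pattern of `inn ω` on `(u, a₂, c, b)`; both lie in the fifteen consistent states
(`state4_mem_consistent4`, transitivity; no definitions — the states and the Finset of consistent states
are spelled out).  The joint cells are pairwise disjoint, cover the configurations, and have PRODUCT
probability (`Pocket.prob_off_inter_inn`): so every event whose membership is a Boolean
function of the joint state has probability `∑ (filtered joint states) x_v · w_w` (`prob_eq_sum_joint`).
The connections of the whole instance are such Boolean functions by the one-excursion closure
(`Pocket3.conn_iff_off_or_excursion` / `conn_pocket_iff`), written out without the existential over the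
terminals: `conn_out_iff` (two outside points) and `conn_in_iff` (an outside point and a pocket point).
-/

namespace Summit.Ventures.PercRepro2

open UnionCluster CovForm

namespace RootLeafU

namespace PocketJoint

variable {V : Type*} {E : Type*}

section States

variable [Fintype E] [Fintype V] [DecidableEq V] (ends : E → Sym2 V)

/-- Every configuration has one of the fifteen consistent patterns (set partitions of four points) on
`(p, q, r, s)`: the six pair connections `(p,q), (p,r), (p,s), (q,r), (q,s), (r,s)` as Booleans. -/
lemma state4_mem_consistent4 (ω' : Config E) (p q r s : V) :
    (decide (Conn ends ω' p q), decide (Conn ends ω' p r), decide (Conn ends ω' p s), decide (Conn ends ω' q r), decide (Conn ends ω' q s), decide (Conn ends ω' r s)) ∈ ({(false, false, false, false, false, false), (false, false, false, false, false, true),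
      (false, false, false, false, true, false), (false, false, false, true, false, false),
      (false, false, true, false, false, false), (false, true, false, false, false, false),
      (true, false, false, false, false, false), (false, false, false, true, true, true),
      (false, true, true, false, false, true), (true, false, true, false, true, false),
      (true, true, false, true, false, false), (true, false, false, false, false, true),
      (false, true, false, false, true, false), (false, false, true, true, false, false),
      (true, true, true, true, true, true)} : Finset (Bool × Bool × Bool × Bool × Bool × Bool)) := by
  have t1 : Conn ends ω' p q → Conn ends ω' p r → Conn ends ω' q r :=
    fun h1 h2 => conn_trans (conn_symm h1) h2
  have t2 : Conn ends ω' p q → Conn ends ω' q r → Conn ends ω' p r := fun h1 h2 => conn_trans h1 h2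
  have t3 : Conn ends ω' p r → Conn ends ω' q r → Conn ends ω' p q :=
    fun h1 h2 => conn_trans h1 (conn_symm h2)
  have t4 : Conn ends ω' p q → Conn ends ω' p s → Conn ends ω' q s :=
    fun h1 h2 => conn_trans (conn_symm h1) h2
  have t5 : Conn ends ω' p q → Conn ends ω' q s → Conn ends ω' p s := fun h1 h2 => conn_trans h1 h2
  have t6 : Conn ends ω' p s → Conn ends ω' q s → Conn ends ω' p q :=
    fun h1 h2 => conn_trans h1 (conn_symm h2)
  have t7 : Conn ends ω' p r → Conn ends ω' p s → Conn ends ω' r s :=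
    fun h1 h2 => conn_trans (conn_symm h1) h2
  have t8 : Conn ends ω' p r → Conn ends ω' r s → Conn ends ω' p s := fun h1 h2 => conn_trans h1 h2
  have t9 : Conn ends ω' p s → Conn ends ω' r s → Conn ends ω' p r :=
    fun h1 h2 => conn_trans h1 (conn_symm h2)
  have t10 : Conn ends ω' q r → Conn ends ω' q s → Conn ends ω' r s :=
    fun h1 h2 => conn_trans (conn_symm h1) h2
  have t11 : Conn ends ω' q r → Conn ends ω' r s → Conn ends ω' q s := fun h1 h2 => conn_trans h1 h2
  have t12 : Conn ends ω' q s → Conn ends ω' r s → Conn ends ω' q r :=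
    fun h1 h2 => conn_trans h1 (conn_symm h2)
  simp only [Finset.mem_insert, Finset.mem_singleton, Prod.mk.injEq]
  by_cases c1 : Conn ends ω' p q <;> by_cases c2 : Conn ends ω' p r <;> by_cases c3 : Conn ends ω' p s <;>
    by_cases c4 : Conn ends ω' q r <;> by_cases c5 : Conn ends ω' q s <;> by_cases c6 : Conn ends ω' r s <;>
    simp_all

end States

section Joint

variable [Fintype E] [DecidableEq E] [Fintype V] [DecidableEq V] {R : Type*} [CommRing R] (p : E → R)
variable {ends : E → Sym2 V} {P : Set V} {off inn : Config E → Config E}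

/-- Additivity over the joint cells: an event whose membership is a Boolean function `φ` of the
joint state (the outside pattern of `off ω` on `(p₁, q₁, r₁, s₁)`, the pocket pattern of `inn ω` on
`(p₂, q₂, r₂, s₂)`) has probability the sum, over the consistent joint states selected by `φ`, of the
PRODUCTS of the outside and the pocket atom probabilities. -/
theorem prob_eq_sum_joint
    (hoff : (∀ ω e, e ∈ touches ends P → off ω e = false) ∧ (∀ ω e, e ∉ touches ends P → off ω e = ω e))
    (hinn : (∀ ω e, e ∈ touches ends P → inn ω e = ω e) ∧ (∀ ω e, e ∉ touches ends P → inn ω e = false))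
    (p₁ q₁ r₁ s₁ p₂ q₂ r₂ s₂ : V) (M : Set (Config E))
    (φ : (Bool × Bool × Bool × Bool × Bool × Bool) × (Bool × Bool × Bool × Bool × Bool × Bool) → Bool)
    (hM : ∀ ω, ω ∈ M ↔ φ ((decide (Conn ends (off ω) p₁ q₁), decide (Conn ends (off ω) p₁ r₁), decide (Conn ends (off ω) p₁ s₁), decide (Conn ends (off ω) q₁ r₁), decide (Conn ends (off ω) q₁ s₁), decide (Conn ends (off ω) r₁ s₁)), (decide (Conn ends (inn ω) p₂ q₂), decide (Conn ends (inn ω) p₂ r₂), decide (Conn ends (inn ω) p₂ s₂), decide (Conn ends (inn ω) q₂ r₂), decide (Conn ends (inn ω) q₂ s₂), decide (Conn ends (inn ω) r₂ s₂))) = true) :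
    prob p M = ∑ v ∈ (({(false, false, false, false, false, false), (false, false, false, false, false, true),
      (false, false, false, false, true, false), (false, false, false, true, false, false),
      (false, false, true, false, false, false), (false, true, false, false, false, false),
      (true, false, false, false, false, false), (false, false, false, true, true, true),
      (false, true, true, false, false, true), (true, false, true, false, true, false),
      (true, true, false, true, false, false), (true, false, false, false, false, true),
      (false, true, false, false, true, false), (false, false, true, true, false, false),
      (true, true, true, true, true, true)} : Finset (Bool × Bool × Bool × Bool × Bool × Bool)) ×ˢ ({(false, false, false, false, false, false), (false, false, false, false, false, true),
      (false, false, false, false, true, false), (false, false, false, true, false, false),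
      (false, false, true, false, false, false), (false, true, false, false, false, false),
      (true, false, false, false, false, false), (false, false, false, true, true, true),
      (false, true, true, false, false, true), (true, false, true, false, true, false),
      (true, true, false, true, false, false), (true, false, false, false, false, true),
      (false, true, false, false, true, false), (false, false, true, true, false, false),
      (true, true, true, true, true, true)} : Finset (Bool × Bool × Bool × Bool × Bool × Bool))).filter (fun v => φ v = true),
      prob p {ω : Config E | off ω ∈ {ω' : Config E | (decide (Conn ends ω' p₁ q₁), decide (Conn ends ω' p₁ r₁), decide (Conn ends ω' p₁ s₁), decide (Conn ends ω' q₁ r₁), decide (Conn ends ω' q₁ s₁), decide (Conn ends ω' r₁ s₁)) = v.1}} * prob p {ω : Config E | inn ω ∈ {ω' : Config E | (decide (Conn ends ω' p₂ q₂), decide (Conn ends ω' p₂ r₂), decide (Conn ends ω' p₂ s₂), decide (Conn ends ω' q₂ r₂), decide (Conn ends ω' q₂ s₂), decide (Conn ends ω' r₂ s₂)) = v.2}} := by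
  have hMeq : M = ⋃ v ∈ (({(false, false, false, false, false, false), (false, false, false, false, false, true),
      (false, false, false, false, true, false), (false, false, false, true, false, false),
      (false, false, true, false, false, false), (false, true, false, false, false, false),
      (true, false, false, false, false, false), (false, false, false, true, true, true),
      (false, true, true, false, false, true), (true, false, true, false, true, false),
      (true, true, false, true, false, false), (true, false, false, false, false, true),
      (false, true, false, false, true, false), (false, false, true, true, false, false),
      (true, true, true, true, true, true)} : Finset (Bool × Bool × Bool × Bool × Bool × Bool)) ×ˢ ({(false, false, false, false, false, false), (false, false, false, false, false, true),
      (false, false, false, false, true, false), (false, false, false, true, false, false),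
      (false, false, true, false, false, false), (false, true, false, false, false, false),
      (true, false, false, false, false, false), (false, false, false, true, true, true),
      (false, true, true, false, false, true), (true, false, true, false, true, false),
      (true, true, false, true, false, false), (true, false, false, false, false, true),
      (false, true, false, false, true, false), (false, false, true, true, false, false),
      (true, true, true, true, true, true)} : Finset (Bool × Bool × Bool × Bool × Bool × Bool))).filter (fun v => φ v = true),
      ({ω : Config E | off ω ∈ {ω' : Config E | (decide (Conn ends ω' p₁ q₁), decide (Conn ends ω' p₁ r₁), decide (Conn ends ω' p₁ s₁), decide (Conn ends ω' q₁ r₁), decide (Conn ends ω' q₁ s₁), decide (Conn ends ω' r₁ s₁)) = v.1}} ∩ {ω : Config E | inn ω ∈ {ω' : Config E | (decide (Conn ends ω' p₂ q₂), decide (Conn ends ω' p₂ r₂), decide (Conn ends ω' p₂ s₂), decide (Conn ends ω' q₂ r₂), decide (Conn ends ω' q₂ s₂), decide (Conn ends ω' r₂ s₂)) = v.2}}) := by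
    ext ω
    simp only [Set.mem_iUnion, Finset.mem_filter, Finset.mem_product, exists_prop, Set.mem_inter_iff,
      Set.mem_setOf_eq]
    constructor
    · intro h
      exact ⟨_, ⟨⟨state4_mem_consistent4 ends (off ω) p₁ q₁ r₁ s₁,
        state4_mem_consistent4 ends (inn ω) p₂ q₂ r₂ s₂⟩, (hM ω).1 h⟩, rfl, rfl⟩
    · rintro ⟨v, ⟨_, hφ⟩, hv1, hv2⟩
      apply (hM ω).2
      rw [← hφ]
      congr 1
      exact Prod.ext hv1 hv2
  classical
  rw [hMeq, RootLeafO.prob_biUnion]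
  · apply Finset.sum_congr rfl
    intro v _
    exact Pocket.prob_off_inter_inn p hoff hinn _ _
  · intro v _ w _ hvw
    rw [Set.disjoint_left]
    rintro ω ⟨h1, h2⟩ ⟨h3, h4⟩
    apply hvw
    simp only [Set.mem_setOf_eq] at h1 h2 h3 h4
    exact Prod.ext (h1.symm.trans h3) (h2.symm.trans h4)

end Joint

section Closure

variable {ends : E → Sym2 V} {P : Set V} {u a₂ c : V} {off inn : Config E → Config E}

/-- **Two outside points**, the one-excursion closure without the existential: `x ↔ y` iff outside, or
through the pocket between two DISTINCT terminals (a trivial excursion `s = t` is an outside path). -/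
theorem conn_out_iff
    (hP : ∀ e y z, ends e = s(y, z) → y ∈ P → z ∈ P ∨ z = u ∨ z = a₂ ∨ z = c)
    (hoff : (∀ ω e, e ∈ touches ends P → off ω e = false) ∧ (∀ ω e, e ∉ touches ends P → off ω e = ω e))
    (hinn : (∀ ω e, e ∈ touches ends P → inn ω e = ω e) ∧ (∀ ω e, e ∉ touches ends P → inn ω e = false))
    {ω : Config E} {x y : V} (hx : x ∉ P) (hy : y ∉ P) :
    Conn ends ω x y ↔ Conn ends (off ω) x y ∨
      (Conn ends (off ω) x u ∧ Conn ends (inn ω) u a₂ ∧ Conn ends (off ω) a₂ y) ∨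
      (Conn ends (off ω) x a₂ ∧ Conn ends (inn ω) u a₂ ∧ Conn ends (off ω) u y) ∨
      (Conn ends (off ω) x u ∧ Conn ends (inn ω) u c ∧ Conn ends (off ω) c y) ∨
      (Conn ends (off ω) x c ∧ Conn ends (inn ω) u c ∧ Conn ends (off ω) u y) ∨
      (Conn ends (off ω) x a₂ ∧ Conn ends (inn ω) a₂ c ∧ Conn ends (off ω) c y) ∨
      (Conn ends (off ω) x c ∧ Conn ends (inn ω) a₂ c ∧ Conn ends (off ω) a₂ y) := by
  rw [Pocket3.conn_iff_off_or_excursion hP hoff hinn hx hy]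
  constructor
  · rintro (h | ⟨s, t, hs, ht, hxs, hst, hty⟩)
    · exact Or.inl h
    · rcases hs with rfl | rfl | rfl <;> rcases ht with rfl | rfl | rfl
      · exact Or.inl (conn_trans hxs hty)
      · exact Or.inr (Or.inl ⟨hxs, hst, hty⟩)
      · exact Or.inr (Or.inr (Or.inr (Or.inl ⟨hxs, hst, hty⟩)))
      · exact Or.inr (Or.inr (Or.inl ⟨hxs, conn_symm hst, hty⟩))
      · exact Or.inl (conn_trans hxs hty)
      · exact Or.inr (Or.inr (Or.inr (Or.inr (Or.inr (Or.inl ⟨hxs, hst, hty⟩)))))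
      · exact Or.inr (Or.inr (Or.inr (Or.inr (Or.inl ⟨hxs, conn_symm hst, hty⟩))))
      · exact Or.inr (Or.inr (Or.inr (Or.inr (Or.inr (Or.inr ⟨hxs, conn_symm hst, hty⟩)))))
      · exact Or.inl (conn_trans hxs hty)
  · rintro (h | ⟨h1, h2, h3⟩ | ⟨h1, h2, h3⟩ | ⟨h1, h2, h3⟩ | ⟨h1, h2, h3⟩ | ⟨h1, h2, h3⟩ | ⟨h1, h2, h3⟩)
    · exact Or.inl h
    · exact Or.inr ⟨u, a₂, Or.inl rfl, Or.inr (Or.inl rfl), h1, h2, h3⟩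
    · exact Or.inr ⟨a₂, u, Or.inr (Or.inl rfl), Or.inl rfl, h1, conn_symm h2, h3⟩
    · exact Or.inr ⟨u, c, Or.inl rfl, Or.inr (Or.inr rfl), h1, h2, h3⟩
    · exact Or.inr ⟨c, u, Or.inr (Or.inr rfl), Or.inl rfl, h1, conn_symm h2, h3⟩
    · exact Or.inr ⟨a₂, c, Or.inr (Or.inl rfl), Or.inr (Or.inr rfl), h1, h2, h3⟩
    · exact Or.inr ⟨c, a₂, Or.inr (Or.inr rfl), Or.inr (Or.inl rfl), h1, conn_symm h2, h3⟩

/-- **An outside point and a pocket point**: `x ↔ y` iff `x` reaches a terminal (in the whole instance)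
that the pocket part joins to `y`. -/
theorem conn_in_iff
    (hP : ∀ e y z, ends e = s(y, z) → y ∈ P → z ∈ P ∨ z = u ∨ z = a₂ ∨ z = c)
    (hoff : (∀ ω e, e ∈ touches ends P → off ω e = false) ∧ (∀ ω e, e ∉ touches ends P → off ω e = ω e))
    (hinn : (∀ ω e, e ∈ touches ends P → inn ω e = ω e) ∧ (∀ ω e, e ∉ touches ends P → inn ω e = false))
    {ω : Config E} {x y : V} (hx : x ∉ P) (hy : y ∈ P) (hu : u ∉ P) (ha : a₂ ∉ P) (hc : c ∉ P) :
    Conn ends ω x y ↔ (Conn ends ω x u ∧ Conn ends (inn ω) u y) ∨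
      (Conn ends ω x a₂ ∧ Conn ends (inn ω) a₂ y) ∨ (Conn ends ω x c ∧ Conn ends (inn ω) c y) := by
  rw [Pocket3.conn_pocket_iff hP hoff hinn hx hy]
  constructor
  · rintro ⟨s, hs, hM, hsy⟩
    have hxs : Conn ends ω x s := by
      rcases hM with h | ⟨s', t', hs', ht', hxs', hs't', ht's⟩
      · exact conn_mono (Pocket.off_le hoff ω) h
      · exact conn_trans (conn_mono (Pocket.off_le hoff ω) hxs')
          (conn_trans (conn_mono (Pocket.inn_le hinn ω) hs't') (conn_mono (Pocket.off_le hoff ω) ht's))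
    rcases hs with rfl | rfl | rfl
    · exact Or.inl ⟨hxs, hsy⟩
    · exact Or.inr (Or.inl ⟨hxs, hsy⟩)
    · exact Or.inr (Or.inr ⟨hxs, hsy⟩)
  · rintro (⟨h1, h2⟩ | ⟨h1, h2⟩ | ⟨h1, h2⟩)
    · exact ⟨u, Or.inl rfl, (Pocket3.conn_iff_off_or_excursion hP hoff hinn hx hu).1 h1, h2⟩
    · exact ⟨a₂, Or.inr (Or.inl rfl), (Pocket3.conn_iff_off_or_excursion hP hoff hinn hx ha).1 h1, h2⟩
    · exact ⟨c, Or.inr (Or.inr rfl), (Pocket3.conn_iff_off_or_excursion hP hoff hinn hx hc).1 h1, h2⟩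

end Closure

end PocketJoint

end RootLeafU

end Summit.Ventures.PercRepro2
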